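import Mathlib
import Literature.NumberTheory.Transcendental.LandauDefectLatticeTate
import Summits.KontsevichZagierPeriods.KontsevichZagierPeriods.Theses.InverseLandau

/-!
# Crux `InverseLandauRationalCurves` (item stmt-KontsevichZagierPeriods-13872) — line `Sketch`

Skeleton of the line "Gauss–Manin orbit + horizontal descent + Rosenlicht, trace-and-order kill
of the constant" (crux ideas `gauss-manin-orbit-rosenlicht`, `silent-logarithms`,
`compositum-logs-ax-schanuel`, which agree on the mechanism):

* `stub_horizontalClassification` — a `∇`-stable subspace of `K × K^ι` (Kummer connection of a
  Landau datum `g`) missing the constant line is spanned by HORIZONTAL vectors `(κ, c)` with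
  constant entries, `c ∈ k₁ ⊗ Λ′` (defect lattice) — Wronskian lemma + Rosenlicht Prop. 4.
* `stub_constantsAlgebraic` — constants of the extension of `d/dϖ` to an algebraic extension of
  `k(ϖ)` are algebraic over `k`.
* `stub_hermiteData` — partial fractions: `F = (M/D^n)′ + Σ_p a_p/(X - p)` over a field where the
  reduced denominator `D` splits.
* `stub_residualVanishing` — at a place over `ϖ = 0`, the numerator of a loop form
  `Σ_p a_p Q/(X - p)` with integral coefficients has coefficients of valuation `< 1`.
* `stub_tateExpansionCalculus` — the formal calculus of the `ϖ`-expansion: absorption,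
  `d/dϖ`-commutation, termwise fundamental theorem of calculus, and the hypothesis `∫ G = 0`.
* `stub_kernel` (lead) — the crux over a finite Galois extension of `k(ϖ)` splitting `Q`, from the
  five statements above (tensor-product period functional `K′ ⊗_{k(ϖ)} k((ϖ))`, Gauss–Manin
  stability, trace-and-order).
* `stub_transport` — from one algebraic extension splitting the denominator to every algebraically
  closed `K ⊇ k(ϖ)`.

`InverseLandauRationalCurves_of` assembles them and concludes the crux BY NAME.
-/

noncomputable section

open Polynomial
open scoped LaurentSeries
open Literature.NumberTheory.Transcendental.AyoubRel

namespace Summit.KontsevichZagierPeriods.InverseLandau.RationalCurves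

/-! ## Stub E — classification of `∇`-stable subspaces missing the constant line -/

/-- **Horizontal classification.** Let `D` be a `k₁`-derivation of the field `K` whose constants
are `k₁` and such that every `k₁`-derivation of `K` is a multiple of `D`; let `g : ι → Kˣ` be a
Landau datum and `∇(b, a) = (Db + Σᵢ aᵢ·Dgᵢ/gᵢ, Da)` the Kummer connection on `K × K^ι`. A
`K`-subspace `N` stable under `∇` and meeting the line `K × 0` only in `0` is spanned by finitely
many of its vectors `(κ, c)` with `c` constant (entries in `k₁`), `c` in the `k₁`-span of the
defect lattice `Λ′ = {n | ∏ gᵢ^{nᵢ} algebraic over k₁}`, and `Dκ + Σ cᵢ Dgᵢ/gᵢ = 0`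
(Wronskian lemma of minimal support + Rosenlicht 1976 Prop. 4). -/
theorem stub_horizontalClassification
    {k₁ K : Type*} [Field k₁] [CharZero k₁] [Field K] [Algebra k₁ K]
    (D : Derivation k₁ K K)
    (hconst : ∀ x : K, D x = 0 → x ∈ Set.range (algebraMap k₁ K))
    (hDer : ∀ δ : Derivation k₁ K K, ∃ f : K, ∀ x, δ x = f * D x)
    {ι : Type*} [Fintype ι] (g : ι → Kˣ)
    (N : Submodule K (K × (ι → K)))
    (hN : ∀ v ∈ N,
      ((D v.1 + ∑ i, v.2 i * ((g i : K)⁻¹ * D (g i)), fun i => D (v.2 i)) : K × (ι → K)) ∈ N)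
    (hline : ∀ b : K, ((b, 0) : K × (ι → K)) ∈ N → b = 0) :
    ∃ s : Finset (K × (ι → K)), (↑s : Set (K × (ι → K))) ⊆ N ∧
      Submodule.span K (↑s : Set (K × (ι → K))) = N ∧
      ∀ v ∈ s, (∃ w : ι → k₁, (∀ i, v.2 i = algebraMap k₁ K (w i)) ∧
          w ∈ Submodule.span k₁ ((fun n : ι → ℤ => fun i => ((n i : ℤ) : k₁)) ''
            (Landau.defectLattice k₁ g : Set (ι → ℤ)))) ∧
        D v.1 + ∑ i, v.2 i * ((g i : K)⁻¹ * D (g i)) = 0 := by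
  sorry

/-! ## Stub C — constants of `d/dϖ` on an algebraic extension of `k(ϖ)` are algebraic -/

/-- **Constants are algebraic.** If `K ⊇ k(ϖ)` is algebraic and `D` is a `k`-derivation of `K`
with `Dϖ = 1`, then every `x` with `Dx = 0` is algebraic over `k` (differentiate the minimal
polynomial of `x` over `k(ϖ)`; the constants of `d/dϖ` on `k(ϖ)` are `k` in characteristic
zero). -/
theorem stub_constantsAlgebraic
    {k K : Type*} [Field k] [CharZero k] [Field K] [Algebra k K] [Algebra (RatFunc k) K]
    [IsScalarTower k (RatFunc k) K] [Algebra.IsAlgebraic (RatFunc k) K]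
    (D : Derivation k K K) (hD : D (algebraMap (RatFunc k) K RatFunc.X) = 1)
    {x : K} (hx : D x = 0) : IsAlgebraic k x := by
  sorry

/-! ## Stub PF — Hermite / partial-fraction data -/

/-- **Hermite data.** Over a field `L` of characteristic zero, a rational function whose reduced
denominator `D` splits is the derivative of some `M/Dⁿ` plus a simple-pole part supported on the
roots of `D`: `F = (M′·D - n·M·D′)/D^{n+1} + Σ_p a_p/(X - p)` (partial fractions; pole orders
`≥ 2` are exact in characteristic zero). -/
theorem stub_hermiteData {L : Type*} [Field L] [CharZero L] [DecidableEq L] (F : RatFunc L)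
    (hF : F.denom.Splits) :
    ∃ (M : L[X]) (n : ℕ) (a : L → L), (∀ x, x ∉ F.denom.rootSet L → a x = 0) ∧
      F = algebraMap L[X] (RatFunc L) (derivative M * F.denom - n • (M * derivative F.denom)) /
            algebraMap L[X] (RatFunc L) (F.denom ^ (n + 1)) +
          ∑ p ∈ F.denom.roots.toFinset, RatFunc.C (a p) * (RatFunc.X - RatFunc.C p)⁻¹ := by
  sorry

/-! ## Stub F — residual vanishing at a place over `ϖ = 0` -/

/-- **Residual vanishing.** Let `c` be a place of `K ⊇ k(ϖ)` over `ϖ = 0` and suppose the image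
`Q_K` of `Q` splits in `K`. For coefficients `a_p` integral at `c`, every coefficient of the loop
numerator `Σ_p a_p · Q_K/(X - p)` (sum over the distinct roots `p` of `Q_K`) has valuation `< 1`:
each root has `val > 1` (poles run to infinity), the coefficients of `Q_K/(X - p)` are
`lc · e_j(roots ∖ p)`, and `val(lc · ∏ roots) = val Q(0, ϖ) = 1`. -/
theorem stub_residualVanishing
    {k : Type*} [Field k] (T : TateFamily₁ k) {K : Type*} [Field K] [DecidableEq K] [Algebra k K]
    [Algebra (RatFunc k) K] [IsScalarTower k (RatFunc k) K]
    (c : Landau.Place k K) (hϖ : c.val (algebraMap (RatFunc k) K RatFunc.X) < 1)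
    (hsplit : ((TateFamily₁.toParamPoly T.Q).map (algebraMap (RatFunc k) K)).Splits)
    (a : K → K) (ha : ∀ x, c.val (a x) ≤ 1) (i : ℕ) :
    c.val ((∑ p ∈ ((TateFamily₁.toParamPoly T.Q).map (algebraMap (RatFunc k) K)).roots.toFinset,
      a p • (((TateFamily₁.toParamPoly T.Q).map (algebraMap (RatFunc k) K)) /ₘ (X - C p))).coeff
        i) < 1 := by
  sorry

/-! ## Stub FC — the formal calculus of the Tate expansion -/

/-- **Tate expansion calculus.** Write `Q = Σ_l q_l(ϖ) z^l`, `P = Σ_i p_i(ϖ) z^i`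
(`q_l, p_i ∈ k[ϖ]`, via the swap `k[z][ϖ] → k[ϖ][z]`), let `u = Q⁻¹ ∈ k[z]⟦ϖ⟧` and
`J(i, m) := ∫₀¹ zⁱ u^m dz ∈ k⟦ϖ⟧ ⊂ k((ϖ))` (coefficientwise `∫₀¹ zʲ dz = 1/(j+1)`). Then:
(absorption) `Σ_l q_l · J(i+l, m+1) = J(i, m)`; (parameter derivative)
`d/dϖ J(i, m) = -m · Σ_l q_l′ · J(i+l, m+1)`; (termwise FTC)
`i · J(i-1, n) - n · Σ_l (l+1) q_{l+1} · J(i+l, n+1) = Q(1,ϖ)^{-n} - [i = 0] · Q(0,ϖ)^{-n}`;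
(hypothesis) `∫ G = 0` reads `Σ_i p_i · J(i, 1) = 0`. (`let`-free form: `J`, `Qs`, `Ps` are
quantified together with their defining equations.) -/
theorem stub_tateExpansionCalculus
    {k : Type*} [Field k] [CharZero k] (T : TateFamily₁ k) (u : PowerSeries (Polynomial k))
    (hu : (T.Q : PowerSeries (Polynomial k)) * u = 1) (J : ℕ → ℕ → k⸨X⸩)
    (hJ : ∀ i m : ℕ, J i m = ((PowerSeries.mk fun n =>
      (PowerSeries.coeff n (PowerSeries.C (X ^ i : Polynomial k) * u ^ m)).sum
        fun j a => a / ((j : k) + 1) : PowerSeries k) : k⸨X⸩))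
    (Qs Ps : Polynomial (Polynomial k))
    (hQs : Qs = Polynomial.eval₂ (Polynomial.mapRingHom (Polynomial.C : k →+* Polynomial k))
      (C X) T.Q)
    (hPs : Ps = Polynomial.eval₂ (Polynomial.mapRingHom (Polynomial.C : k →+* Polynomial k))
      (C X) T.P) :
    (∀ i m : ℕ, ∑ l ∈ Qs.support, ((Qs.coeff l : PowerSeries k) : k⸨X⸩) * J (i + l) (m + 1) =
        J i m) ∧
    (∀ i m : ℕ, LaurentSeries.derivative k (J i m) =
        -(m : k⸨X⸩) * ∑ l ∈ Qs.support,
          ((derivative (Qs.coeff l) : PowerSeries k) : k⸨X⸩) * J (i + l) (m + 1)) ∧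
    (∀ i n : ℕ, (i : k⸨X⸩) * J (i - 1) n -
        (n : k⸨X⸩) * ∑ l ∈ (derivative Qs).support,
          (((derivative Qs).coeff l : PowerSeries k) : k⸨X⸩) * J (i + l) (n + 1) =
        ((algebraMap (Polynomial k) (RatFunc k) (T.Q.map (evalRingHom 1)))⁻¹ ^ n : RatFunc k) -
          (if i = 0 then
            (((algebraMap (Polynomial k) (RatFunc k) (T.Q.map (evalRingHom 0)))⁻¹ ^ n :
              RatFunc k) : k⸨X⸩) else 0)) ∧
    (∀ G : PowerSeries (Polynomial k), (T.Q : PowerSeries (Polynomial k)) * G = T.P →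
      (∀ j : ℕ, (PowerSeries.coeff j G).sum (fun i a => a / ((i : k) + 1)) = 0) →
      ∑ i ∈ Ps.support, ((Ps.coeff i : PowerSeries k) : k⸨X⸩) * J i 1 = 0) := by
  sorry

/-! ## Stub TRANSPORT — from one splitting extension to every algebraically closed field -/

/-- **Transport.** If the conclusion of the crux holds over some algebraic extension `K′` of
`k(ϖ)` in which the reduced denominator of `F` splits, it holds over every algebraically closed
`K ⊇ k(ϖ)`: embed `K′ → K` over `k(ϖ)` (`IsAlgClosed.lift`), map `A, B, c_q`, transport the
exponent vectors along the bijection of pole sets, and map the identity of rational functions. -/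
theorem stub_transport {k : Type} [Field k] [CharZero k] (T : TateFamily₁ k)
    (K' : Type) [Field K'] [Algebra (RatFunc k) K'] [Algebra.IsAlgebraic (RatFunc k) K']
    (hsplit : (T.toRatFunc.denom.map (algebraMap (RatFunc k) K')).Splits)
    (h : ∃ (A B : Polynomial K') (s : ℕ) (c : Fin s → K')
        (nv : Fin s → (landauSet K' T.toRatFunc → ℤ)),
      B.eval 0 ≠ 0 ∧ B.eval 1 ≠ 0 ∧ A.eval 1 * B.eval 0 = A.eval 0 * B.eval 1 ∧
      (∀ q, nv q ∈ Landau.relationLattice (landauDatum K' T.toRatFunc)) ∧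
      algebraMap (Polynomial K') (RatFunc K')
          ((TateFamily₁.toParamPoly T.P).map (algebraMap (RatFunc k) K')) /
        algebraMap (Polynomial K') (RatFunc K')
          ((TateFamily₁.toParamPoly T.Q).map (algebraMap (RatFunc k) K')) =
      algebraMap (Polynomial K') (RatFunc K') (derivative A * B - A * derivative B) /
        algebraMap (Polynomial K') (RatFunc K') (B ^ 2) +
      ∑ q, RatFunc.C (c q) * ∑ p : landauSet K' T.toRatFunc,
        RatFunc.C ((nv q p : ℤ) : K') * (RatFunc.X - RatFunc.C (p : K'))⁻¹)
    (K : Type) [Field K] [IsAlgClosed K] [Algebra (RatFunc k) K] :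
    ∃ (A B : Polynomial K) (s : ℕ) (c : Fin s → K)
        (nv : Fin s → (landauSet K T.toRatFunc → ℤ)),
      B.eval 0 ≠ 0 ∧ B.eval 1 ≠ 0 ∧ A.eval 1 * B.eval 0 = A.eval 0 * B.eval 1 ∧
      (∀ q, nv q ∈ Landau.relationLattice (landauDatum K T.toRatFunc)) ∧
      algebraMap (Polynomial K) (RatFunc K)
          ((TateFamily₁.toParamPoly T.P).map (algebraMap (RatFunc k) K)) /
        algebraMap (Polynomial K) (RatFunc K)
          ((TateFamily₁.toParamPoly T.Q).map (algebraMap (RatFunc k) K)) =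
      algebraMap (Polynomial K) (RatFunc K) (derivative A * B - A * derivative B) /
        algebraMap (Polynomial K) (RatFunc K) (B ^ 2) +
      ∑ q, RatFunc.C (c q) * ∑ p : landauSet K T.toRatFunc,
        RatFunc.C ((nv q p : ℤ) : K) * (RatFunc.X - RatFunc.C (p : K))⁻¹ := by
  sorry

/-! ## Stub KERNEL (lead) — the crux over a splitting Galois extension, from the five lemmas -/

/-- **The kernel theorem over a splitting field** (lead's stub). Given the five statements above
(as hypotheses, verbatim), a Tate family `P/Q` whose expansion `G` integrates termwise to `0`
admits, over any finite Galois extension `K′ ⊇ k(ϖ)` in which `Q` splits, a decomposition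
`F = E′ + Σ_q c_q Σ_p n_{q,p}/(z - p)` with `E = A/B` regular at `0, 1`, `E(1) = E(0)` and every
`n_q` an exact multiplicative relation among the Landau functions. Mechanism: the period
functional `I(N/Q^m) = Σ_i N_i ⊗ ∫ zⁱu^m ∈ K′ ⊗_{k(ϖ)} k((ϖ))` is `K′`-linear, satisfies the
termwise FTC and commutes with `d/dϖ`; the boundary/residue data of its kernel form a
`∇`-stable subspace missing the constant line (Gauss–Manin horizontality); horizontal
classification puts the residue vector in `K′ ⊗ Λ` (`Λ′ = Λ` at the Tate point), and the
boundary constants `κ` die by trace-and-order (`Tr ⊗ id` of a loop period has positive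
`ϖ`-order, while `Tr(1) = [K′ : k(ϖ)] ≠ 0`). -/
theorem stub_kernel
    (hE : ∀ {k₁ K : Type} [Field k₁] [CharZero k₁] [Field K] [Algebra k₁ K]
      (D : Derivation k₁ K K)
      (_hconst : ∀ x : K, D x = 0 → x ∈ Set.range (algebraMap k₁ K))
      (_hDer : ∀ δ : Derivation k₁ K K, ∃ f : K, ∀ x, δ x = f * D x)
      {ι : Type} [Fintype ι] (g : ι → Kˣ)
      (N : Submodule K (K × (ι → K)))
      (_hN : ∀ v ∈ N,
        ((D v.1 + ∑ i, v.2 i * ((g i : K)⁻¹ * D (g i)), fun i => D (v.2 i)) : K × (ι → K)) ∈ N)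
      (_hline : ∀ b : K, ((b, 0) : K × (ι → K)) ∈ N → b = 0),
      ∃ s : Finset (K × (ι → K)), (↑s : Set (K × (ι → K))) ⊆ N ∧
        Submodule.span K (↑s : Set (K × (ι → K))) = N ∧
        ∀ v ∈ s, (∃ w : ι → k₁, (∀ i, v.2 i = algebraMap k₁ K (w i)) ∧
            w ∈ Submodule.span k₁ ((fun n : ι → ℤ => fun i => ((n i : ℤ) : k₁)) ''
              (Landau.defectLattice k₁ g : Set (ι → ℤ)))) ∧
          D v.1 + ∑ i, v.2 i * ((g i : K)⁻¹ * D (g i)) = 0)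
    (hC : ∀ {k K : Type} [Field k] [CharZero k] [Field K] [Algebra k K] [Algebra (RatFunc k) K]
      [IsScalarTower k (RatFunc k) K] [Algebra.IsAlgebraic (RatFunc k) K]
      (D : Derivation k K K) (_hD : D (algebraMap (RatFunc k) K RatFunc.X) = 1)
      {x : K} (_hx : D x = 0), IsAlgebraic k x)
    (hPF : ∀ {L : Type} [Field L] [CharZero L] [DecidableEq L] (F : RatFunc L) (_hF : F.denom.Splits),
      ∃ (M : L[X]) (n : ℕ) (a : L → L), (∀ x, x ∉ F.denom.rootSet L → a x = 0) ∧
        F = algebraMap L[X] (RatFunc L) (derivative M * F.denom - n • (M * derivative F.denom)) /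
              algebraMap L[X] (RatFunc L) (F.denom ^ (n + 1)) +
            ∑ p ∈ F.denom.roots.toFinset, RatFunc.C (a p) * (RatFunc.X - RatFunc.C p)⁻¹)
    (hF : ∀ {k : Type} [Field k] (T : TateFamily₁ k) {K : Type} [Field K] [DecidableEq K] [Algebra k K]
      [Algebra (RatFunc k) K] [IsScalarTower k (RatFunc k) K]
      (c : Landau.Place k K) (_hϖ : c.val (algebraMap (RatFunc k) K RatFunc.X) < 1)
      (_hsplit : ((TateFamily₁.toParamPoly T.Q).map (algebraMap (RatFunc k) K)).Splits)
      (a : K → K) (_ha : ∀ x, c.val (a x) ≤ 1) (i : ℕ),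
      c.val ((∑ p ∈ ((TateFamily₁.toParamPoly T.Q).map (algebraMap (RatFunc k) K)).roots.toFinset,
        a p • (((TateFamily₁.toParamPoly T.Q).map (algebraMap (RatFunc k) K)) /ₘ (X - C p))).coeff
          i) < 1)
    (hFC : ∀ {k : Type} [Field k] [CharZero k] (T : TateFamily₁ k) (u : PowerSeries (Polynomial k))
      (_hu : (T.Q : PowerSeries (Polynomial k)) * u = 1) (J : ℕ → ℕ → k⸨X⸩)
      (_hJ : ∀ i m : ℕ, J i m = ((PowerSeries.mk fun n =>
        (PowerSeries.coeff n (PowerSeries.C (X ^ i : Polynomial k) * u ^ m)).sum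
          fun j a => a / ((j : k) + 1) : PowerSeries k) : k⸨X⸩))
      (Qs Ps : Polynomial (Polynomial k))
      (_hQs : Qs = Polynomial.eval₂ (Polynomial.mapRingHom (Polynomial.C : k →+* Polynomial k))
        (C X) T.Q)
      (_hPs : Ps = Polynomial.eval₂ (Polynomial.mapRingHom (Polynomial.C : k →+* Polynomial k))
        (C X) T.P),
      (∀ i m : ℕ, ∑ l ∈ Qs.support, ((Qs.coeff l : PowerSeries k) : k⸨X⸩) * J (i + l) (m + 1) =
          J i m) ∧
      (∀ i m : ℕ, LaurentSeries.derivative k (J i m) =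
          -(m : k⸨X⸩) * ∑ l ∈ Qs.support,
            ((derivative (Qs.coeff l) : PowerSeries k) : k⸨X⸩) * J (i + l) (m + 1)) ∧
      (∀ i n : ℕ, (i : k⸨X⸩) * J (i - 1) n -
          (n : k⸨X⸩) * ∑ l ∈ (derivative Qs).support,
            (((derivative Qs).coeff l : PowerSeries k) : k⸨X⸩) * J (i + l) (n + 1) =
          ((algebraMap (Polynomial k) (RatFunc k) (T.Q.map (evalRingHom 1)))⁻¹ ^ n : RatFunc k) -
            (if i = 0 then
              (((algebraMap (Polynomial k) (RatFunc k) (T.Q.map (evalRingHom 0)))⁻¹ ^ n :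
                RatFunc k) : k⸨X⸩) else 0)) ∧
      (∀ G : PowerSeries (Polynomial k), (T.Q : PowerSeries (Polynomial k)) * G = T.P →
        (∀ j : ℕ, (PowerSeries.coeff j G).sum (fun i a => a / ((i : k) + 1)) = 0) →
        ∑ i ∈ Ps.support, ((Ps.coeff i : PowerSeries k) : k⸨X⸩) * J i 1 = 0))
    (k : Type) [Field k] [CharZero k] (T : TateFamily₁ k) (G : PowerSeries (Polynomial k))
    (hG : (T.Q : PowerSeries (Polynomial k)) * G = (T.P : PowerSeries (Polynomial k)))
    (hint : ∀ j : ℕ, (PowerSeries.coeff j G).sum (fun i a => a / ((i : k) + 1)) = 0)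
    (K' : Type) [Field K'] [Algebra (RatFunc k) K'] [FiniteDimensional (RatFunc k) K']
    [IsGalois (RatFunc k) K']
    (hsplitQ : ((TateFamily₁.toParamPoly T.Q).map (algebraMap (RatFunc k) K')).Splits) :
    ∃ (A B : Polynomial K') (s : ℕ) (c : Fin s → K')
        (nv : Fin s → (landauSet K' T.toRatFunc → ℤ)),
      B.eval 0 ≠ 0 ∧ B.eval 1 ≠ 0 ∧ A.eval 1 * B.eval 0 = A.eval 0 * B.eval 1 ∧
      (∀ q, nv q ∈ Landau.relationLattice (landauDatum K' T.toRatFunc)) ∧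
      algebraMap (Polynomial K') (RatFunc K')
          ((TateFamily₁.toParamPoly T.P).map (algebraMap (RatFunc k) K')) /
        algebraMap (Polynomial K') (RatFunc K')
          ((TateFamily₁.toParamPoly T.Q).map (algebraMap (RatFunc k) K')) =
      algebraMap (Polynomial K') (RatFunc K') (derivative A * B - A * derivative B) /
        algebraMap (Polynomial K') (RatFunc K') (B ^ 2) +
      ∑ q, RatFunc.C (c q) * ∑ p : landauSet K' T.toRatFunc,
        RatFunc.C ((nv q p : ℤ) : K') * (RatFunc.X - RatFunc.C (p : K'))⁻¹ := by
  sorry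

/-! ## Composition -/

/-- `toParamPoly Q ≠ 0`: its value at `z = 0` is the image of `Q(0, ϖ) ∈ k[ϖ]`, whose constant
term is `c₀ ≠ 0`. -/
theorem toParamPoly_Q_ne_zero {k : Type} [Field k] (T : TateFamily₁ k) :
    TateFamily₁.toParamPoly T.Q ≠ 0 := by
  intro h
  have h1 : (TateFamily₁.toParamPoly T.Q).eval 0 = 0 := by rw [h, eval_zero]
  have h2 : (TateFamily₁.toParamPoly T.Q).eval 0 =
      algebraMap (Polynomial k) (RatFunc k) (T.Q.map (evalRingHom 0)) := by
    have key : ((evalRingHom (0 : RatFunc k)).comp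
        (TateFamily₁.toParamPoly (k := k))) =
        (algebraMap (Polynomial k) (RatFunc k)).comp (mapRingHom (evalRingHom (0 : k))) := by
      refine Polynomial.ringHom_ext (fun q => ?_) ?_
      · simp only [RingHom.coe_comp, Function.comp_apply, coe_evalRingHom, coe_mapRingHom,
          map_C, TateFamily₁.toParamPoly, coe_eval₂RingHom, eval₂_C]
        rw [Polynomial.eval_map, Polynomial.eval₂_at_zero, Polynomial.coeff_zero_eq_eval_zero,
          IsScalarTower.algebraMap_apply k (Polynomial k) (RatFunc k), Polynomial.algebraMap_eq]
      · simp only [RingHom.coe_comp, Function.comp_apply, coe_evalRingHom, coe_mapRingHom,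
          map_X, TateFamily₁.toParamPoly, coe_eval₂RingHom, eval₂_X, eval_C]
        rfl
    exact congr_fun (congr_arg DFunLike.coe key) T.Q
  rw [h2, map_eq_zero_iff _ (IsFractionRing.injective (Polynomial k) (RatFunc k))] at h1
  have h3 : (T.Q.map (evalRingHom (0 : k))).coeff 0 = 0 := by rw [h1, coeff_zero]
  rw [coeff_map, T.coeff_Q_zero, coe_evalRingHom, eval_C] at h3
  exact T.c₀_ne_zero h3

/-- The reduced denominator of `F = P/Q` divides the image of `Q`, hence splits wherever `Q`
does. -/
theorem denom_map_splits {k : Type} [Field k] (T : TateFamily₁ k) {K : Type} [Field K]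
    [Algebra (RatFunc k) K]
    (hsplitQ : ((TateFamily₁.toParamPoly T.Q).map (algebraMap (RatFunc k) K)).Splits) :
    (T.toRatFunc.denom.map (algebraMap (RatFunc k) K)).Splits :=
  Splits.of_dvd hsplitQ ((Polynomial.map_ne_zero_iff (algebraMap (RatFunc k) K).injective).2
    (toParamPoly_Q_ne_zero T)) (Polynomial.map_dvd _ T.denom_toRatFunc_dvd)

/-- **Composition**: the crux `InverseLandauRationalCurves` from the stubs. The kernel theorem is
applied over the splitting field `K′` of `Q` over `k(ϖ)` (finite, and Galois in characteristic
zero), and transported to the given algebraically closed `K`. -/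
theorem InverseLandauRationalCurves_of :
    Summit.KontsevichZagierPeriods.KontsevichZagierPeriods.Theses.InverseLandau.InverseLandauRationalCurves := by
  intro k _ _ T G hG hint K _ _ _
  -- the splitting field of `Q` over `k(ϖ)`
  let Q' : Polynomial (RatFunc k) := TateFamily₁.toParamPoly T.Q
  let K' : Type := Q'.SplittingField
  haveI : CharZero (RatFunc k) := inferInstance
  haveI : Algebra.IsSeparable (RatFunc k) K' := Algebra.IsAlgebraic.isSeparable_of_perfectField
  haveI : IsGalois (RatFunc k) K' := IsGalois.mk
  have hsplitQ : (Q'.map (algebraMap (RatFunc k) K')).Splits := SplittingField.splits Q'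
  have hker := stub_kernel stub_horizontalClassification stub_constantsAlgebraic stub_hermiteData
    stub_residualVanishing stub_tateExpansionCalculus k T G hG hint K' hsplitQ
  exact stub_transport T K' (denom_map_splits T hsplitQ) hker K

end Summit.KontsevichZagierPeriods.InverseLandau.RationalCurves

end
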